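import Summits.QuantumFields.YangMills.Theorems.BalabanUVNodesPortS1FlatKernel

/-!
# NODE O port PT-A — THE Z-BRIDGE's DIMENSION MATCH FROM PRINT-SHAPED LETTERS: if `LQ̃(Vk)` is 𝔰𝔲(2)-valued and its `b₀`-block is invertible (standing range), then
# `finrank (fluctKer Vk) = #NonB0Idx` — so `…PortS1ZkGraph`'s displayed `σ` is replaced by «`LQ̃` is 𝔰𝔲(2)-valued» (automatic for the derivative of the logarithm of an `SU(2)`-valued average
# wherever `Q̃(Vk, ·)` is differentiable with values near `1`; a theorem at `Vk = 1`, `…FlatKernel`)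

Cell `ym-nodeO-ideate`, porter seat `ymgap-nodeO-port-PTA-1` (gen 4); `--supports stmt-QuantumFields-27930` (helper).  [I] = [Balaban1987RG1].
* `recordLQtMat_mulVec_eq_zero_iff_of_lieSU`, ★ `finrank_fluctKer_of_lieSU`, `nonempty_fluctKer_equiv_of_lieSU`, ★★ `recordZkkCan_eq_recordZkkLoc_of_lieSU`, `recordZkΔ1Can_eq_recordZkLoc_of_lieSU`.

HONEST FRAMING.  Linear algebra; NOTHING of Bałaban asserted∕ported∕discharged; 27930 OPEN; K0⁷∕K-Ax OPEN; NODE O 0∕1; COUNT 8∕28 · K 1∕4 UNMOVED; finite `𝕋⁴_{L^K}` at fixed ε — NOT continuum ∕ OS ∕ Clay;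
**the Yang–Mills mass gap is NOT proved by any of this.**  No `sorry`, no `def`, no `instance`; standard axioms.
-/

noncomputable section

open scoped BigOperators Matrix.Norms.L2Operator Topology

namespace Summit.QuantumFields.YangMills.Theorems.BalabanUVNodesPortS1

open Summit.QuantumFields.YangMills.Theorems.K0RecordFormatNames
open Literature.MathematicalPhysics.QuantumFieldTheory.Balaban1983to89
open Literature.MathematicalPhysics.QuantumFieldTheory.Balaban1983to89.Node00
open Literature.MathematicalPhysics.QuantumFieldTheory.Balaban1983to89.T4Continuum (T4Family)
open Literature.MathematicalPhysics.QuantumFieldTheory.Balaban1983to89.T4AdjointCovarianceUnitary (lieSU)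
open _root_.Matrix

variable (F : T4Family)

/-- Coordinate kernel = `fluctKer Vk` whenever `LQ̃(Vk)` is 𝔰𝔲(2)-valued. [cite: Balaban1987RG1, p.267–268 (bookkeeping)] -/
theorem recordLQtMat_mulVec_eq_zero_iff_of_lieSU (k K : ℕ) (Vk : GaugeField (F.P K) k (SU 2))
    (hsu : ∀ (x : FluctIdx F k K → ℝ) (c : PBond (F.P K) (k + 1)), recordLQt F k K Vk x c ∈ lieSU (Fin 2)) (x : FluctIdx F k K → ℝ) :
    recordLQtMat F k K Vk *ᵥ x = 0 ↔ x ∈ fluctKer F k K Vk := by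
  rw [fluctKer, LinearMap.mem_ker, ContinuousLinearMap.coe_coe]
  constructor
  · intro h
    funext c
    refine eq_zero_of_mem_lieSU_of_su2Coord (hsu x c) fun j => ?_
    have := congrFun h (c, j)
    rwa [recordLQtMat_mulVec] at this
  · intro h
    funext cj
    rw [recordLQtMat_mulVec, h]
    obtain ⟨c, j⟩ := cj
    fin_cases j <;> simp [su2Coord]

open Classical in
/-- ★ **Dimension match from print-shaped letters**: `LQ̃(Vk)` 𝔰𝔲(2)-valued + `b₀`-block invertible (standing range) ⟹ `finrank (fluctKer Vk) = #NonB0Idx`. [cite: Balaban1987RG1, p.267–268] -/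
theorem finrank_fluctKer_of_lieSU (k K : ℕ) (hk : k + 1 ≤ (F.P K).m + (F.P K).K) (Vk : GaugeField (F.P K) k (SU 2)) (hA : RecordB0BlockInvertible F k K Vk)
    (hsu : ∀ (x : FluctIdx F k K → ℝ) (c : PBond (F.P K) (k + 1)), recordLQt F k K Vk x c ∈ lieSU (Fin 2)) :
    Module.finrank ℝ (fluctKer F k K Vk) = Fintype.card (NonB0Idx F k K) := by
  set M := recordLQtMat F k K Vk with hM
  have hker : LinearMap.ker M.mulVecLin = fluctKer F k K Vk := by
    ext x
    rw [LinearMap.mem_ker, Matrix.mulVecLin_apply]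
    exact recordLQtMat_mulVec_eq_zero_iff_of_lieSU F k K Vk hsu x
  have hrange : LinearMap.range M.mulVecLin = ⊤ := LinearMap.range_eq_top.mpr (recordLQtMat_mulVec_surjective F k K hk Vk hA)
  have hrn := LinearMap.finrank_range_add_finrank_ker M.mulVecLin
  rw [hrange, finrank_top, hker, Module.finrank_fintype_fun_eq_card, Module.finrank_fintype_fun_eq_card,
    ← Fintype.card_congr (Equiv.ofBijective _ (blkToFluct_bijective F k K hk)), Fintype.card_sum] at hrn
  omega

open Classical in
/-- The `σ` of `…PortS1ZkGraph` from the print-shaped letters. [cite: Balaban1987RG1, p.267–268 (bookkeeping)] -/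
theorem nonempty_fluctKer_equiv_of_lieSU (k K : ℕ) (hk : k + 1 ≤ (F.P K).m + (F.P K).K) (Vk : GaugeField (F.P K) k (SU 2)) (hA : RecordB0BlockInvertible F k K Vk)
    (hsu : ∀ (x : FluctIdx F k K → ℝ) (c : PBond (F.P K) (k + 1)), recordLQt F k K Vk x c ∈ lieSU (Fin 2)) :
    Nonempty (Fin (Module.finrank ℝ (fluctKer F k K Vk)) ≃ NonB0Idx F k K) :=
  ⟨(Fintype.equivFinOfCardEq (finrank_fluctKer_of_lieSU F k K hk Vk hA hsu).symm).symm⟩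

open Classical in
/-- ★★ **THE Z-BRIDGE (corrected (2.11) form) FROM PRINT-SHAPED LETTERS**: standing range, `b₀`-block invertible, `LQ̃(Vk)` 𝔰𝔲(2)-valued, `recordPreckLoc` positive definite ⟹
`recordZkkCan = recordZkkLoc`. [cite: Balaban1987RG1, (1.4) p.260, p.267–268] -/
theorem recordZkkCan_eq_recordZkkLoc_of_lieSU (k K : ℕ) (hk : k + 1 ≤ (F.P K).m + (F.P K).K) (εbg : ℝ) (Vk : GaugeField (F.P K) k (SU 2))
    (hopLin : (PBond (F.P K) (k + 1) → MatA 2) →ₗ[ℝ] (FluctIdx F k K → ℝ)) (hA : RecordB0BlockInvertible F k K Vk)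
    (hsu : ∀ (x : FluctIdx F k K → ℝ) (c : PBond (F.P K) (k + 1)), recordLQt F k K Vk x c ∈ lieSU (Fin 2)) (hP : (recordPreckLoc F k K εbg Vk hopLin).PosDef) :
    recordZkkCan F k K εbg Vk hopLin = recordZkkLoc F k K εbg Vk hopLin :=
  recordZkkCan_eq_recordZkkLoc F k K εbg Vk hopLin hk hA (Classical.choice (nonempty_fluctKer_equiv_of_lieSU F k K hk Vk hA hsu)) hP

open Classical in
/-- The same for the `Δ₁`∕`𝒞` form: `recordZkΔ1Can = recordZkLoc`. [cite: Balaban1987RG1, (1.4)–(1.5) pp.260–261, p.267–268] -/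
theorem recordZkΔ1Can_eq_recordZkLoc_of_lieSU (k K : ℕ) (hk : k + 1 ≤ (F.P K).m + (F.P K).K) (εbg : ℝ) (U : GaugeField (F.P K) 0 (SU 2)) (Vk : GaugeField (F.P K) k (SU 2))
    (𝒞 : (FineIdx F K → ℝ) →ₗ[ℝ] (FineIdx F K → ℝ) →ₗ[ℝ] ℝ) (hopLin : (PBond (F.P K) (k + 1) → MatA 2) →ₗ[ℝ] (FluctIdx F k K → ℝ)) (hA : RecordB0BlockInvertible F k K Vk)
    (hsu : ∀ (x : FluctIdx F k K → ℝ) (c : PBond (F.P K) (k + 1)), recordLQt F k K Vk x c ∈ lieSU (Fin 2)) (hP : (recordPrecLoc F k K εbg U Vk 𝒞 hopLin).PosDef) :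
    recordZkΔ1Can F k K εbg U Vk 𝒞 hopLin = recordZkLoc F k K εbg U Vk 𝒞 hopLin :=
  recordZkΔ1Can_eq_recordZkLoc F k K εbg U Vk 𝒞 hopLin hk hA (Classical.choice (nonempty_fluctKer_equiv_of_lieSU F k K hk Vk hA hsu)) hP

end Summit.QuantumFields.YangMills.Theorems.BalabanUVNodesPortS1

end
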